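import Summits.BirchSwinnertonDyer.Rank1Residual.Additive.GordCycLowerBound
import Summits.BirchSwinnertonDyer.Rank1Residual.Additive.XMultRankZeroCyclotomicPrimePrep
import HarnessLib

/-!
# T-O7 step 2 on the potentially MULTIPLICATIVE locus (M), part 1: `p`-adic Gross–Zagier on the
# quadratic branch of the multiplicative twist `E♭` — typed (`BranchPAdicGrossZagierMultAt`), PROVED in
# rank 0 (Birch + MTT one-term measure, both parities, no period fact), and `B(0) = 0` in rank one
# (cell `b2b-bsdres`, team n1011, seat p01, OWNERS row T-O7; sibling of `GordBranchPAdicGrossZagier[Odd].lean`;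
# part 2 = `PotMultBranchPAdicGrossZagierRankOne.lean`, the rank-one FACTORISATION and class forms)

HONEST FRAMING (cell `b2b-bsdres`, run/shared/lean/b2b/bsd-rank1-residual/, verbatim in every
file): prove what is provable now; shrink each hard class to its core with data; no claim beyond
stated classes. Research routes; census output = EVIDENCE / conjecture items, never a Literature
fact; RESIDUAL-MAP marks change only by signed lines. §I O7 stays OPEN; X4(M) / X3♯(M) stay
CONSTRUCTION-SHAPED; nothing is booked; no label changes. COVERAGE (stated first, referee 1
proviso): the potentially multiplicative rows `E = E♭ ⊗ χ_{p*}`, `E♭ = V` MULTIPLICATIVE at the ODD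
prime `p` (split: `a_p = 1`, non-split: `a_p = −1`; `p* = (−1)^{(p−1)/2} p`; BOTH parities of
`(p−1)/2`, `p = 3` INCLUDED) — the (M) complement of the defect-2 good-ordinary rows of the two
sibling files; the class corollary is stated on `PotMult W p` / X4(M) at EVERY odd `p` over p16's
`Delbourgo2002.mainTheorem_potMult` in part 2. ONE definition (typed input, `@[conjecture]`,
nothing asserted — PROVED in rank `0`) and theorems; no Literature fact minted, no `_holds`.

## What

* `BranchPAdicGrossZagierMultAt W p Dh` (§0): for every multiplicative `V` with `C • V^{(p*)} = W`,
  newform `f`, branch series `B = L^±_p(f, a_p, ω^{(p−1)/2}, T)` of the one-term measure (plus/minus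
  by the parity of `(p−1)/2`, `a_p = ±1` by the reduction sign — the (M) disjuncts of p10's
  conjecture `QuadraticBranchLowerDivisibilityAt`, VERBATIM) and period ratio `ϖ` of that parity:
  `L^{(r)}(E,1)/r! = q·Ω_E·Reg_∞` and `ϖ·[T^r]B·log_p(γ)^r = u·q·Reg_p(E,Dh)`, `u ∈ ℤ_p^×`,
  `r = rank E(ℚ)`.
* §1 toolkit + RANK 0 PROVED (`branchPAdicGrossZagierMultAt_of_analyticRank_eq_zero`): Birch for the
  twist by `p*` with NO period fact (`entireLFunction_one_eq_of_twist_explicit` /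
  `entireLFunction_one_eq_of_twist_neg`: `L(E,1) = ε·ϖ·∑(a/p)[a/p]^±_f·Ω_E/m`, `ord_p m = 0`) and the
  one-term constant terms `B(0) = a_p⁻¹·∑(a/p)[a/p]^±_f` (`constantCoeff_padicLFunction{Plus,Minus}BranchMult_half`).
* §2 RANK 1: `B(0) = 0` (`constantCoeff_multBranch_eq_zero_of_analyticRank_eq_one`); the factorisation
  with p10's Λ-adic conjecture and the class forms are part 2.

References: [MazurTateTeitelbaum1986Invent] §I.8, §I.10, §I.13–I.14; [Delbourgo1998] Thm. 1, §2.5;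
[Delbourgo2002] Thm. (B), Example p. 40; [Miller2011LMS] Def. 1.1.
-/

noncomputable section

open scoped Classical MatrixGroups ModularForm NumberField

open CongruenceSubgroup WeierstrassCurve NumberField Literature.NumberTheory.EllipticCurves
  Literature.NumberTheory.EllipticCurves.ModularForms
  Literature.NumberTheory.EllipticCurves.Rank1Residual
  Literature.NumberTheory.EllipticCurves.Rank1Residual.Typed
  Literature.NumberTheory.EllipticCurves.Delbourgo2002
  Literature.NumberTheory.GaloisRepresentations
  IsDedekindDomain

namespace Summit.BirchSwinnertonDyer.Rank1Residual.Additive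

/-! ### §0 The typed analytic input on the (M) locus -/

/-- **TYPED INPUT — `p`-adic Gross–Zagier on the quadratic branch, potentially MULTIPLICATIVE case
(nothing asserted).** For `W = E`, `p` odd and a `p`-adic height datum `Dh`: for every globally
minimal `V` MULTIPLICATIVE at `p` with `C • V^{(p*)} = W`, every newform `f` of `V`, the branch series
`B` of the one-term measure of `f` on the component `ω^{(p−1)/2}` (plus symbols if `(p−1)/2` is even,
minus symbols if odd; `a_p = 1` split, `a_p = −1` non-split — the (M) disjuncts of p10's
`QuadraticBranchLowerDivisibilityAt`, verbatim) and every period ratio `ϖ` of that parity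
(`ϖ·Ω_V = Ω⁺_f`, resp. `ϖ·|Ω⁻(V)| = Ω⁻_f`), writing `r = rank_ℤ E(ℚ)`:
`L^{(r)}(E,1)/r! = q·Ω_E·Reg_∞(E)` with `q ∈ ℚ` and `ϖ·[T^r]B·log_p(γ_cyc)^r = u·q·Reg_p(E,Dh)`,
`u ∈ ℤ_p^×`. Rank `0`: a THEOREM (§1). Rank `1`: OPEN (r3 ROUTE-r3 §4 S3 on the (M) rows).
[cite: Delbourgo1998, Thm. 1 and §2.5 (pp. 151–152) (shape only; nothing asserted)]
[cite: MazurTateTeitelbaum1986Invent, §I.13–I.14] -/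
@[conjecture] def BranchPAdicGrossZagierMultAt (W : WeierstrassCurve ℚ) [W.IsElliptic] (p : ℕ)
    [Fact p.Prime] (Dh : PAdicHeightData W p) : Prop :=
  ∀ (V : WeierstrassCurve ℚ) [V.IsElliptic] [V.IsGloballyMinimal] {N : ℕ} [NeZero N]
    {f : CuspForm (Gamma0 N) 2} (B : PowerSeries ℚ_[p]),
    p ≠ 2 → (∃ C : VariableChange ℚ, C • V.quadraticTwist ((-1 : ℚ) ^ (p / 2) * p) = W) →
    ((V.HasSplitMultiplicativeReductionAtPrime p ∧
        B = if Even (p / 2) then padicLFunctionPlusBranchMult f (1 : ℚ_[p]) (p / 2)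
          else padicLFunctionMinusBranchMult f (1 : ℚ_[p]) (p / 2)) ∨
      (V.HasMultiplicativeReductionAtPrime p ∧ ¬ V.HasSplitMultiplicativeReductionAtPrime p ∧
        B = if Even (p / 2) then padicLFunctionPlusBranchMult f (-1 : ℚ_[p]) (p / 2)
          else padicLFunctionMinusBranchMult f (-1 : ℚ_[p]) (p / 2))) →
    IsNewformOf V f → ∀ (ϖ : ℚ),
      (if Even (p / 2) then (ϖ : ℝ) * V.realPeriodRat = plusPeriod f
        else (ϖ : ℝ) * V.imaginaryPeriodRat = minusPeriod f) →
      ∃ (u : ℤ_[p]ˣ) (q : ℚ),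
        W.leadingLCoeff = (q : ℂ) * (W.realPeriodRat : ℂ) * (W.regulator : ℂ) ∧
        ((ϖ : ℚ) : ℚ_[p]) * PowerSeries.coeff W.mordellWeilRank B *
            padicLog p (cyclotomicGenerator p) ^ W.mordellWeilRank =
          ((u : ℤ_[p]) : ℚ_[p]) * (q : ℚ_[p]) * padicRegulator Dh

variable (W : WeierstrassCurve ℚ) [W.IsElliptic] [W.IsGloballyMinimal] (p : ℕ) [hp : Fact p.Prime]

/-! ### §1 Toolkit (Birch for the twist by `p*`, one-term constant terms) and rank 0 -/

/-- **Birch for the twist by `p*`, both parities, NO period fact, packaged with a `p`-adic unit.**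
For `W = C • V^{(p*)}` additive at the odd prime `p`, `V` good or multiplicative at `p` with newform
`f`, and `ϖ` the period ratio of the parity of `(p−1)/2`: there are `ε = ±1` and a rational `m ≠ 0`
with `ord_p m = 0` (`m = |u(C)|`, resp. `|u(C)|·c_∞(E)`) such that
`L(E,1) = (ε·ϖ·∑_{a mod p}(a/p)[a/p]^±_f / m)·Ω_E` (`entireLFunction_one_eq_of_twist_explicit`,
`entireLFunction_one_eq_of_twist_neg`, `padicValRat_u_eq_zero_of_twist_pm_p`,
`padicValRat_numRealComponents_eq_zero`). [cite: MazurTateTeitelbaum1986Invent, §I.8 (Birch's formula)]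
[cite: SilvermanAEC2009, VII.1 Prop. 1.3(b)] -/
theorem exists_entireLFunction_one_eq_of_pStar_twist_unit (hmod : hasEntireLFunction_rat)
    (hp2 : p ≠ 2) (V : WeierstrassCurve ℚ) [V.IsElliptic] [V.IsGloballyMinimal]
    (C : VariableChange ℚ) (hC : C • V.quadraticTwist ((-1 : ℚ) ^ (p / 2) * p) = W)
    (hV : Good V p ∨ Mult V p) (hadd : Addv W p) {N : ℕ} [NeZero N] {f : CuspForm (Gamma0 N) 2}
    (hf : IsNewformOf V f) (ϖ : ℚ)
    (hϖ : if Even (p / 2) then (ϖ : ℝ) * V.realPeriodRat = plusPeriod f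
      else (ϖ : ℝ) * V.imaginaryPeriodRat = minusPeriod f) :
    ∃ (ε m : ℚ), (ε = 1 ∨ ε = -1) ∧ m ≠ 0 ∧ padicValRat p m = 0 ∧
      W.entireLFunction 1 =
        ((ε * (ϖ * (if Even (p / 2) then legendrePlusSymbolSum f p else legendreMinusSymbolSum f p)) /
            m : ℚ) : ℂ) * (W.realPeriodRat : ℂ) := by
  have hodd : p % 4 = 1 ∨ p % 4 = 3 := by
    obtain ⟨k, hk⟩ := hp.out.odd_of_ne_two hp2
    omega
  have hua0 : |(C.u : ℚ)| ≠ 0 := abs_ne_zero.mpr C.u.ne_zero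
  have hvua : padicValRat p |(C.u : ℚ)| = 0 := by
    have hu0 : padicValRat p (C.u : ℚ) = 0 := by
      rcases hodd with h1 | h3
      · refine padicValRat_u_eq_zero_of_twist_pm_p p hp2 V W hV (Or.inl rfl) C ?_
        rw [pStar_eq_of_mod_four p (Or.inl h1), if_pos h1] at hC
        push_cast
        exact hC
      · refine padicValRat_u_eq_zero_of_twist_pm_p p hp2 V W hV (Or.inr rfl) C ?_
        rw [pStar_eq_of_mod_four p (Or.inr h3), if_neg (by omega)] at hC
        push_cast
        exact hC
    rcases abs_choice (C.u : ℚ) with h | h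
    · rw [h, hu0]
    · rw [h, padicValRat.neg, hu0]
  rcases hodd with h1 | h3
  · have heven : Even (p / 2) := ⟨p / 4, by omega⟩
    rw [if_pos heven] at hϖ
    have hC' : C • V.quadraticTwist (p : ℚ) = W := by
      rw [pStar_eq_of_mod_four p (Or.inl h1), if_pos h1] at hC
      exact hC
    obtain ⟨ε, hε, hL⟩ := entireLFunction_one_eq_of_twist_explicit p hmod h1 V W C hC' hadd hf ϖ hϖ
    refine ⟨ε, |(C.u : ℚ)|, hε, hua0, hvua, ?_⟩
    rw [if_pos heven]
    exact hL
  · have hne : ¬ Even (p / 2) := by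
      rw [Nat.not_even_iff_odd]
      exact ⟨p / 4, by omega⟩
    rw [if_neg hne] at hϖ
    have hC' : C • V.quadraticTwist (-(p : ℚ)) = W := by
      rw [pStar_eq_of_mod_four p (Or.inr h3), if_neg (by omega)] at hC
      exact hC
    obtain ⟨ε, hε, hL⟩ := entireLFunction_one_eq_of_twist_neg p hmod h3 V W C hC' hadd hf ϖ hϖ
    set cinf : ℕ := (W.baseChange ℝ).numRealComponents with hcinf
    have hcinf0 : (cinf : ℚ) ≠ 0 := by
      rw [hcinf, numRealComponents]
      split_ifs <;> norm_num
    refine ⟨ε, |(C.u : ℚ)| * (cinf : ℚ), hε, mul_ne_zero hua0 hcinf0, ?_, ?_⟩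
    · rw [padicValRat.mul hua0 hcinf0, hvua, hcinf, padicValRat_numRealComponents_eq_zero W p hp2,
        add_zero]
    · rw [if_neg hne]
      exact hL

/-- **The one-term branch series at `T = 0`, multiplicative `V`, both parities and both signs:**
`B(0) = a·∑_{a mod p}(a/p)[a/p]^±_f` with `a = a_p(f) = a_p⁻¹ ∈ {±1}` (`a_p = 1` split, `−1`
non-split: `IsNewformOf.cuspCoeff_eq_one_and_sq_of_split`, `…_eq_neg_one_and_dvd_of_nonsplit`; MTT
§I.10 with `ε(p) = 0`: `constantCoeff_padicLFunction{Plus,Minus}BranchMult_half`).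
[cite: MazurTateTeitelbaum1986Invent, §I.10 (10.1), §I.13–I.14] -/
theorem exists_sign_constantCoeff_multBranch (hp2 : p ≠ 2) (V : WeierstrassCurve ℚ) [V.IsElliptic]
    [V.IsGloballyMinimal] {N : ℕ} [NeZero N] {f : CuspForm (Gamma0 N) 2} (hf : IsNewformOf V f)
    (B : PowerSeries ℚ_[p])
    (hVB : (V.HasSplitMultiplicativeReductionAtPrime p ∧
        B = if Even (p / 2) then padicLFunctionPlusBranchMult f (1 : ℚ_[p]) (p / 2)
          else padicLFunctionMinusBranchMult f (1 : ℚ_[p]) (p / 2)) ∨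
      (V.HasMultiplicativeReductionAtPrime p ∧ ¬ V.HasSplitMultiplicativeReductionAtPrime p ∧
        B = if Even (p / 2) then padicLFunctionPlusBranchMult f (-1 : ℚ_[p]) (p / 2)
          else padicLFunctionMinusBranchMult f (-1 : ℚ_[p]) (p / 2))) :
    ∃ a : ℤ, (a = 1 ∨ a = -1) ∧
      PowerSeries.constantCoeff B =
        (a : ℚ_[p]) *
          ((if Even (p / 2) then legendrePlusSymbolSum f p else legendreMinusSymbolSum f p : ℚ) :
            ℚ_[p]) := by
  rcases hVB with ⟨hsplit, rfl⟩ | ⟨hmult, hns, rfl⟩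
  · have hap : cuspCoeff f p = ((1 : ℤ) : ℂ) := by
      rw [(hf.cuspCoeff_eq_one_and_sq_of_split hsplit).1, Int.cast_one]
    have hpN : p ∣ N := hf.dvd_level_of_split hsplit
    have hcast : ((1 : ℤ) : ℚ_[p]) = 1 := by norm_num
    refine ⟨1, Or.inl rfl, ?_⟩
    by_cases heven : Even (p / 2)
    · have h := constantCoeff_padicLFunctionPlusBranchMult_half p hp2 hf.1 hf.coeffField_eq_bot hpN hap
        (by norm_num)
      rw [hcast] at h
      rw [if_pos heven, if_pos heven, h, hcast, inv_one]
    · have h := constantCoeff_padicLFunctionMinusBranchMult_half p hp2 hf.1 hf.coeffField_eq_bot hpN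
        hap (by norm_num)
      rw [hcast] at h
      rw [if_neg heven, if_neg heven, h, hcast, inv_one]
  · obtain ⟨hap1, hpN⟩ := hf.cuspCoeff_eq_neg_one_and_dvd_of_nonsplit hmult hns
    have hap : cuspCoeff f p = ((-1 : ℤ) : ℂ) := by rw [hap1]; norm_num
    have hcast : ((-1 : ℤ) : ℚ_[p]) = -1 := by norm_num
    refine ⟨-1, Or.inr rfl, ?_⟩
    by_cases heven : Even (p / 2)
    · have h := constantCoeff_padicLFunctionPlusBranchMult_half p hp2 hf.1 hf.coeffField_eq_bot hpN hap
        (by norm_num)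
      rw [hcast] at h
      rw [if_pos heven, if_pos heven, h, hcast, inv_neg, inv_one]
    · have h := constantCoeff_padicLFunctionMinusBranchMult_half p hp2 hf.1 hf.coeffField_eq_bot hpN
        hap (by norm_num)
      rw [hcast] at h
      rw [if_neg heven, if_neg heven, h, hcast, inv_neg, inv_one]

/-- **Rank 0, (M): `BranchPAdicGrossZagierMultAt W p Dh` HOLDS for every height datum.**
`ϖ·B(0) = a·ϖ·∑` and `L(E,1) = ε·ϖ·∑·Ω_E/m` (`a, ε = ±1`, `ord_p m = 0`), `Reg_∞ = Reg_p = 1`: the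
identity holds with `q = ε·ϖ·∑/m` and the unit `u = a·ε·m`. Binders: modularity (`hmod`), GZK
(`hGZK`, for `rank = 0`). [cite: MazurTateTeitelbaum1986Invent, §I.8, §I.10, §I.14] -/
theorem branchPAdicGrossZagierMultAt_of_analyticRank_eq_zero (hmod : hasEntireLFunction_rat)
    (hGZK : rank_eq_analyticRank_of_analyticRank_le_one) (hadd : Addv W p) (hr : W.analyticRank = 0)
    (Dh : PAdicHeightData W p) : BranchPAdicGrossZagierMultAt W p Dh := by
  intro V _ _ N _ f B hp2 hVW hVB hf ϖ hϖ
  obtain ⟨C, hC⟩ := hVW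
  have hmult : Mult V p := by
    rcases hVB with ⟨hs, -⟩ | ⟨hm, -, -⟩
    · exact hs.hasMultiplicativeReductionAtPrime
    · exact hm
  obtain ⟨hmw, -⟩ := hGZK W (by rw [hr]; exact zero_le_one)
  have hmw0 : W.mordellWeilRank = 0 := by rw [hmw, hr]
  haveI : Finite W.toAffine.Point := W.finite_point_of_rank_zero hmw0
  have hRegp : padicRegulator Dh = 1 := padicRegulator_eq_one_of_finite W p Dh
  have hReg : W.regulator = 1 := W.regulator_eq_one_of_rank_zero hmw0
  have hlead : W.leadingLCoeff = W.entireLFunction 1 := W.leadingLCoeff_eq_of_analyticRank_eq_zero hr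
  obtain ⟨ε, m, hε, hm0, hvm, hL⟩ :=
    exists_entireLFunction_one_eq_of_pStar_twist_unit W p hmod hp2 V C hC (Or.inr hmult) hadd hf ϖ hϖ
  obtain ⟨a, ha, hB0⟩ := exists_sign_constantCoeff_multBranch p hp2 V hf B hVB
  set S : ℚ := (if Even (p / 2) then legendrePlusSymbolSum f p else legendreMinusSymbolSum f p)
    with hS_def
  -- the unit `u = a·ε·m`
  have hε0 : ε ≠ 0 := by rcases hε with h | h <;> · rw [h]; norm_num
  have ha0 : (a : ℚ) ≠ 0 := by rcases ha with h | h <;> · rw [h]; norm_num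
  have hvε : padicValRat p ε = 0 := by
    rcases hε with h | h
    · rw [h, padicValRat.one]
    · rw [h, padicValRat.neg, padicValRat.one]
  have hva : padicValRat p (a : ℚ) = 0 := by
    rcases ha with h | h
    · rw [h, Int.cast_one, padicValRat.one]
    · rw [h, Int.cast_neg, Int.cast_one, padicValRat.neg, padicValRat.one]
  have ht0 : (a : ℚ) * ε * m ≠ 0 := mul_ne_zero (mul_ne_zero ha0 hε0) hm0
  have htQ : (((a : ℚ) * ε * m : ℚ) : ℚ_[p]) ≠ 0 := by exact_mod_cast ht0
  have hnorm : ‖(((a : ℚ) * ε * m : ℚ) : ℚ_[p])‖ = 1 := by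
    rw [Padic.norm_eq_zpow_neg_valuation htQ, Padic.valuation_ratCast,
      padicValRat.mul (mul_ne_zero ha0 hε0) hm0, padicValRat.mul ha0 hε0, hva, hvε, hvm, add_zero,
      add_zero, neg_zero, zpow_zero]
  obtain ⟨w, hw⟩ := exists_unit_coe_eq_of_norm_eq_one p hnorm
  refine ⟨w, ε * (ϖ * S) / m, ?_, ?_⟩
  · rw [hlead, hL, hReg]
    push_cast
    ring
  · rw [hmw0, pow_zero, mul_one, PowerSeries.coeff_zero_eq_constantCoeff, hB0, hRegp, mul_one, hw]
    have hmQ : ((m : ℚ) : ℚ_[p]) ≠ 0 := by exact_mod_cast hm0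
    rcases hε with rfl | rfl <;> rcases ha with rfl | rfl <;>
    · push_cast
      field_simp

/-! ### §2 Rank 1: `B(0) = 0` -/

/-- **In analytic rank one the (M) branch series vanishes at `T = 0`:** `B(0) = a·∑`, and
`L(E,1) = ε·ϖ·∑·Ω_E/m = 0` with `ε, ϖ, m ≠ 0` forces `∑ = 0`. [cite: MazurTateTeitelbaum1986Invent, §I.8, §I.14] -/
theorem constantCoeff_multBranch_eq_zero_of_analyticRank_eq_one (hmod : hasEntireLFunction_rat)
    (hadd : Addv W p) (hr : W.analyticRank = 1) (hp2 : p ≠ 2)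
    (V : WeierstrassCurve ℚ) [V.IsElliptic] [V.IsGloballyMinimal]
    (C : VariableChange ℚ) (hC : C • V.quadraticTwist ((-1 : ℚ) ^ (p / 2) * p) = W)
    {N : ℕ} [NeZero N] {f : CuspForm (Gamma0 N) 2} (hf : IsNewformOf V f) (B : PowerSeries ℚ_[p])
    (hVB : (V.HasSplitMultiplicativeReductionAtPrime p ∧
        B = if Even (p / 2) then padicLFunctionPlusBranchMult f (1 : ℚ_[p]) (p / 2)
          else padicLFunctionMinusBranchMult f (1 : ℚ_[p]) (p / 2)) ∨
      (V.HasMultiplicativeReductionAtPrime p ∧ ¬ V.HasSplitMultiplicativeReductionAtPrime p ∧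
        B = if Even (p / 2) then padicLFunctionPlusBranchMult f (-1 : ℚ_[p]) (p / 2)
          else padicLFunctionMinusBranchMult f (-1 : ℚ_[p]) (p / 2)))
    (ϖ : ℚ) (hϖ : if Even (p / 2) then (ϖ : ℝ) * V.realPeriodRat = plusPeriod f
      else (ϖ : ℝ) * V.imaginaryPeriodRat = minusPeriod f) :
    PowerSeries.constantCoeff B = 0 := by
  have hmult : Mult V p := by
    rcases hVB with ⟨hs, -⟩ | ⟨hm, -, -⟩
    · exact hs.hasMultiplicativeReductionAtPrime
    · exact hm
  have hϖ0 : ϖ ≠ 0 := by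
    rintro rfl
    by_cases heven : Even (p / 2)
    · rw [if_pos heven, Rat.cast_zero, zero_mul] at hϖ
      have hper : 0 < plusPeriod f := IsNewform0.plusPeriod_pos_holds hf.1 hf.coeffField_eq_bot
      rw [← hϖ] at hper
      exact lt_irrefl _ hper
    · rw [if_neg heven, Rat.cast_zero, zero_mul] at hϖ
      have hper : 0 < minusPeriod f := IsNewform0.minusPeriod_pos_holds hf.1 hf.coeffField_eq_bot
      rw [← hϖ] at hper
      exact lt_irrefl _ hper
  obtain ⟨ε, m, hε, hm0, -, hL⟩ :=
    exists_entireLFunction_one_eq_of_pStar_twist_unit W p hmod hp2 V C hC (Or.inr hmult) hadd hf ϖ hϖ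
  obtain ⟨a, -, hB0⟩ := exists_sign_constantCoeff_multBranch p hp2 V hf B hVB
  set S : ℚ := (if Even (p / 2) then legendrePlusSymbolSum f p else legendreMinusSymbolSum f p)
    with hS_def
  have hL0 : W.entireLFunction 1 = 0 := entireLFunction_one_eq_zero_of_analyticRank_eq_one hr
  have hΩ : (W.realPeriodRat : ℂ) ≠ 0 := by exact_mod_cast W.realPeriodRat_pos_holds.ne'
  have hε0 : ε ≠ 0 := by rcases hε with h | h <;> · rw [h]; norm_num
  have hS : S = 0 := by
    rw [hL0] at hL
    have h := (mul_eq_zero.mp hL.symm).resolve_right hΩ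
    have h' : (ε * (ϖ * S) / m : ℚ) = 0 := by exact_mod_cast h
    simpa [hε0, hϖ0, hm0] using h'
  rw [hB0, hS, Rat.cast_zero, mul_zero]

end Summit.BirchSwinnertonDyer.Rank1Residual.Additive

end
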